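import Mathlib.MeasureTheory.Function.L2Space
import Mathlib.MeasureTheory.Function.LpSpace.Indicator
import Mathlib.Analysis.Normed.Operator.Compact.Basic
import Mathlib.Analysis.InnerProductSpace.Dual
import Mathlib.Topology.MetricSpace.Pseudo.Basic
import HarnessLib

/-!
# Integral operators with continuous kernels on compact sets are compact

A classical compactness criterion, in the form needed for the Fredholm theory of the
hard-sphere linear Boltzmann operator (BGSR Lemma 6.1,
`Literature.MathematicalPhysics.KineticTheory.bgsr_exists_diffusionCorrector`): let `μ` be a
finite measure on a metric space `X`, `H = L²(μ)` (real scalars), `K ⊆ X` compact and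
`κ : X → H` continuous on `K`. Then any bounded operator `S` on `H` acting as
`(S g)(x) = 1_K(x) ⟨κ(x), g⟩` (a.e.) is compact: by uniform continuity of `κ` on `K`, `S` is the
operator-norm limit of the finite-rank operators `g ↦ ∑ⱼ ⟨κ(xⱼ), g⟩ 1_{Cⱼ}` attached to finite
partitions of `K` into small measurable cells `Cⱼ ∋ xⱼ` (Reed–Simon, *Methods of Modern
Mathematical Physics I*, Thm VI.12: norm limits of compact — in particular finite-rank —
operators are compact; §VI.6 for integral operators `A_K`).

## Main result

* `isCompactOperator_of_ae_eq_indicator_inner` — the statement above.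

Auxiliary: `isCompactOperator_smulRight` (rank-one operators are compact),
`isCompactOperator_finset_sum`.

## References

* M. Reed, B. Simon, *Methods of Modern Mathematical Physics I: Functional Analysis*,
  Academic Press (rev. ed. 1980), Thm VI.12, §VI.5–VI.6.
-/

open MeasureTheory Metric Set Filter Topology
open scoped InnerProductSpace ENNReal NNReal

noncomputable section

namespace Literature.Analysis.FunctionSpaces

/-! ## Finite-rank operators are compact -/

section FiniteRank

variable {E F : Type*} [NormedAddCommGroup E] [NormedSpace ℝ E] [NormedAddCommGroup F]
  [NormedSpace ℝ F]

/-- A rank-one operator `g ↦ φ(g) e` is compact. [folklore] -/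
theorem isCompactOperator_smulRight (φ : E →L[ℝ] ℝ) (e : F) :
    IsCompactOperator (φ.smulRight e) := by
  have h1 : IsCompactOperator φ := isCompactOperator_of_locallyCompactSpace_dom φ
  have h2 := h1.clm_comp (ContinuousLinearMap.toSpanSingleton ℝ e)
  have heq : (⇑(ContinuousLinearMap.toSpanSingleton ℝ e) ∘ ⇑φ) = ⇑(φ.smulRight e) := by
    funext g
    simp [ContinuousLinearMap.toSpanSingleton_apply]
  rwa [heq] at h2

/-- Finite sums of compact operators are compact. [folklore] -/
theorem isCompactOperator_finset_sum {ι : Type*} (s : Finset ι) (T : ι → E →L[ℝ] F)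
    (hT : ∀ i ∈ s, IsCompactOperator (T i)) :
    IsCompactOperator ((∑ i ∈ s, T i : E →L[ℝ] F) : E → F) := by
  classical
  induction s using Finset.induction_on with
  | empty =>
    rw [Finset.sum_empty, FunLike.coe_zero]
    exact isCompactOperator_zero
  | insert a s ha ih =>
    rw [Finset.sum_insert ha, FunLike.coe_add]
    exact (hT a (Finset.mem_insert_self a s)).add
      (ih fun i hi => hT i (Finset.mem_insert_of_mem hi))

end FiniteRank

/-! ## The compactness criterion -/

section Kernel

variable {X : Type*} [MetricSpace X] [MeasurableSpace X] [OpensMeasurableSpace X]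
  {μ : Measure X} [IsFiniteMeasure μ]

/-- **Finite-rank approximation.** Under the hypotheses of
`isCompactOperator_of_ae_eq_indicator_inner`, for every `ε > 0` there is a compact (indeed
finite-rank) operator `F` with `‖S - F‖ ≤ (μ univ)^{1/2} ε`. [folklore] -/
theorem exists_isCompactOperator_norm_sub_le {K : Set X} (hK : IsCompact K)
    (κ : X → Lp ℝ 2 μ) (hκ : ContinuousOn κ K) (S : Lp ℝ 2 μ →L[ℝ] Lp ℝ 2 μ)
    (hS : ∀ g : Lp ℝ 2 μ, (S g : X → ℝ) =ᵐ[μ] K.indicator fun x => ⟪κ x, g⟫_ℝ)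
    {ε : ℝ} (hε : 0 < ε) :
    ∃ F : Lp ℝ 2 μ →L[ℝ] Lp ℝ 2 μ, IsCompactOperator F ∧
      ‖S - F‖ ≤ (measureUnivNNReal μ : ℝ) ^ (2 : ℝ)⁻¹ * ε := by
  classical
  -- uniform continuity of `κ` on `K`
  obtain ⟨η, hη, hηκ⟩ := Metric.uniformContinuousOn_iff_le.1
    (hK.uniformContinuousOn_of_continuous hκ) ε hε
  -- a finite `η`-net of `K`, indexed by `ℕ`
  obtain ⟨t, htK, htfin, hcover⟩ := finite_cover_balls_of_compact hK hη
  obtain ⟨n, emb, hrange⟩ := htfin.fin_embedding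
  have hKne : ∀ x ∈ K, ∃ m : ℕ, ∃ hm : m < n, x ∈ ball (emb ⟨m, hm⟩) η := by
    intro x hx
    have hx' := hcover hx
    simp only [mem_iUnion, exists_prop] at hx'
    obtain ⟨y, hyt, hxy⟩ := hx'
    rw [← hrange] at hyt
    obtain ⟨i, rfl⟩ := hyt
    exact ⟨i.1, i.2, by simpa using hxy⟩
  have hemb_mem : ∀ i : Fin n, emb i ∈ K := fun i => htK (hrange ▸ mem_range_self i)
  -- balls indexed by `ℕ` (empty beyond `n`), their disjointification, and the cells of `K`
  set B : ℕ → Set X := fun m => if h : m < n then ball (emb ⟨m, h⟩) η else ∅ with hB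
  have hBmeas : ∀ m, MeasurableSet (B m) := by
    intro m
    simp only [hB]
    split_ifs
    · exact measurableSet_ball
    · exact MeasurableSet.empty
  set C : ℕ → Set X := fun m => K ∩ disjointed B m with hC
  have hCmeas : ∀ m, MeasurableSet (C m) := fun m =>
    hK.isClosed.measurableSet.inter (MeasurableSet.disjointed hBmeas m)
  have hCsub : ∀ m (hm : m < n), C m ⊆ ball (emb ⟨m, hm⟩) η := by
    intro m hm x hx
    have h := disjointed_subset B m hx.2
    simpa [hB, hm] using h
  have hCK : ∀ m, C m ⊆ K := fun m x hx => hx.1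
  have hCdisj : ∀ m m', m ≠ m' → Disjoint (C m) (C m') := fun m m' h =>
    (disjoint_disjointed B h).mono inter_subset_right inter_subset_right
  have hCcover : ∀ x ∈ K, ∃ m : ℕ, m < n ∧ x ∈ C m := by
    intro x hx
    obtain ⟨m, hm, hxm⟩ := hKne x hx
    have hxU : x ∈ ⋃ m, B m := mem_iUnion.2 ⟨m, by simp [hB, hm, hxm]⟩
    rw [← iUnion_disjointed] at hxU
    obtain ⟨m', hm'⟩ := mem_iUnion.1 hxU
    have hm'n : m' < n := by
      by_contra h
      have h' := disjointed_subset B m' hm'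
      simp [hB, h] at h'
    exact ⟨m', hm'n, hx, hm'⟩
  -- the finite-rank approximant
  set e : Fin n → Lp ℝ 2 μ := fun i =>
    indicatorConstLp 2 (hCmeas i.1) (measure_ne_top μ _) (1 : ℝ) with he
  set Fop : Lp ℝ 2 μ →L[ℝ] Lp ℝ 2 μ :=
    ∑ i : Fin n, (innerSL ℝ (κ (emb i))).smulRight (e i) with hFop
  refine ⟨Fop, isCompactOperator_finset_sum _ _ fun i _ => isCompactOperator_smulRight _ _, ?_⟩
  -- the error estimate, pointwise a.e.
  have hFeval : ∀ g : Lp ℝ 2 μ, (Fop g : X → ℝ) =ᵐ[μ]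
      fun x => ∑ i : Fin n, ⟪κ (emb i), g⟫_ℝ * (C i.1).indicator (fun _ => (1 : ℝ)) x := by
    intro g
    have happ : Fop g = ∑ i : Fin n, ⟪κ (emb i), g⟫_ℝ • e i := by
      simp only [hFop, sum_apply, ContinuousLinearMap.smulRight_apply,
        innerSL_apply_apply]
    have hterm : ∀ i : Fin n, ((⟪κ (emb i), g⟫_ℝ • e i : Lp ℝ 2 μ) : X → ℝ) =ᵐ[μ]
        fun x => ⟪κ (emb i), g⟫_ℝ * (C i.1).indicator (fun _ => (1 : ℝ)) x := by
      intro i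
      filter_upwards [Lp.coeFn_smul (⟪κ (emb i), g⟫_ℝ) (e i),
        indicatorConstLp_coeFn (p := 2) (hs := hCmeas i.1) (hμs := measure_ne_top μ _)
          (c := (1 : ℝ))] with x hx hind
      rw [hx, Pi.smul_apply, smul_eq_mul]
      simp only [he] at hind ⊢
      rw [hind]
    have hall := eventually_all.2 hterm
    rw [happ]
    filter_upwards [Lp.coeFn_fun_finsetSum (Finset.univ : Finset (Fin n))
      (fun i => ⟪κ (emb i), g⟫_ℝ • e i), hall] with x hx hx'
    rw [hx]
    exact Finset.sum_congr rfl fun i _ => hx' i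
  have hpt : ∀ g : Lp ℝ 2 μ, ∀ᵐ x ∂μ, ‖(S g - Fop g : Lp ℝ 2 μ) x‖ ≤ ε * ‖g‖ := by
    intro g
    filter_upwards [Lp.coeFn_sub (S g) (Fop g), hS g, hFeval g] with x hsub hSx hFx
    rw [hsub, Pi.sub_apply, hSx, hFx, Real.norm_eq_abs]
    by_cases hx : x ∈ K
    · obtain ⟨m, hm, hxm⟩ := hCcover x hx
      set i₀ : Fin n := ⟨m, hm⟩ with hi₀
      rw [Finset.sum_eq_single i₀, indicator_of_mem hx, indicator_of_mem (show x ∈ C i₀.1 from hxm),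
        mul_one, ← inner_sub_left]
      · refine (abs_real_inner_le_norm _ _).trans (mul_le_mul_of_nonneg_right ?_ (norm_nonneg _))
        have hd : dist x (emb i₀) ≤ η := (mem_ball.1 (hCsub m hm hxm)).le
        have := hηκ x hx (emb i₀) (hemb_mem i₀) hd
        rwa [dist_eq_norm] at this
      · intro i _ hi
        have hne : i.1 ≠ m := fun h => hi (Fin.ext h)
        have hxi : x ∉ C i.1 := fun h' => (hCdisj _ _ hne).le_bot ⟨h', hxm⟩
        rw [indicator_of_notMem hxi, mul_zero]
      · intro h; exact absurd (Finset.mem_univ i₀) h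
    · rw [indicator_of_notMem hx]
      have h0 : ∀ i : Fin n, (C i.1).indicator (fun _ => (1 : ℝ)) x = 0 := fun i =>
        indicator_of_notMem (fun h => hx (hCK _ h)) _
      simp only [h0, mul_zero, Finset.sum_const_zero, sub_zero, abs_zero]
      positivity
  -- the operator-norm bound
  refine ContinuousLinearMap.opNorm_le_bound _ (by positivity) fun g => ?_
  rw [sub_apply]
  have h := Lp.norm_le_of_ae_bound (f := S g - Fop g) (by positivity) (hpt g)
  simp only [ENNReal.toReal_ofNat] at h
  calc ‖S g - Fop g‖ ≤ (measureUnivNNReal μ : ℝ) ^ (2 : ℝ)⁻¹ * (ε * ‖g‖) := h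
    _ = (measureUnivNNReal μ : ℝ) ^ (2 : ℝ)⁻¹ * ε * ‖g‖ := by ring

/-- **Integral operators with continuous kernels on compact sets are compact.** Let `μ` be a
finite measure on a metric space `X`, `K ⊆ X` compact and `κ : X → L²(μ)` continuous on `K`.
A bounded operator `S` on `L²(μ)` acting as `(S g)(x) = 1_K(x) ⟨κ(x), g⟩` for a.e. `x` is a
compact operator (norm limit of finite-rank operators). [folklore] -/
theorem isCompactOperator_of_ae_eq_indicator_inner {K : Set X} (hK : IsCompact K)
    (κ : X → Lp ℝ 2 μ) (hκ : ContinuousOn κ K) (S : Lp ℝ 2 μ →L[ℝ] Lp ℝ 2 μ)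
    (hS : ∀ g : Lp ℝ 2 μ, (S g : X → ℝ) =ᵐ[μ] K.indicator fun x => ⟪κ x, g⟫_ℝ) :
    IsCompactOperator S := by
  have key : ∀ k : ℕ, ∃ F : Lp ℝ 2 μ →L[ℝ] Lp ℝ 2 μ, IsCompactOperator F ∧
      ‖S - F‖ ≤ (measureUnivNNReal μ : ℝ) ^ (2 : ℝ)⁻¹ * (1 / ((k : ℝ) + 1)) := fun k =>
    exists_isCompactOperator_norm_sub_le hK κ hκ S hS (by positivity)
  choose F hFc hFn using key
  refine isCompactOperator_of_tendsto (l := atTop) (F := F) ?_ (Eventually.of_forall hFc)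
  rw [tendsto_iff_norm_sub_tendsto_zero]
  refine squeeze_zero (g := fun k : ℕ => (measureUnivNNReal μ : ℝ) ^ (2 : ℝ)⁻¹ * (1 / ((k : ℝ) + 1)))
    (fun k => norm_nonneg _) (fun k => ?_) ?_
  · rw [norm_sub_rev]; exact hFn k
  · have h := (tendsto_const_nhds (x := (measureUnivNNReal μ : ℝ) ^ (2 : ℝ)⁻¹)).mul
      tendsto_one_div_add_atTop_nhds_zero_nat
    rwa [mul_zero] at h

end Kernel

end Literature.Analysis.FunctionSpaces
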